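import Summits.CriticalPhenomena.PercolationContinuityZ3.Theorems.PercNearOneGluingAdditiveGluingKnThm2GoodAux
import Summits.CriticalPhenomena.PercolationContinuityZ3.Theorems.PercNearOneGluingAdditiveGluingBhkSets
import HarnessLib

/-! # Crux `PercNearOneGluing.AdditiveGluing` (stmt-CriticalPhenomena-4576), line `starglue/tieline`
(skeleton v12) — stub `stub_bhkTwoAny_c7` (BHK Thm. 1.4/1.5, set form, "ANY" on both factors)

Helper file for the crux skeleton of the line `starglue/tieline` (lead
prover-line-stmt-CriticalPhenomena-4576-c7-0): proves exactly the registered stub signature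
`stub_bhkTwoAny_c7`; lands with `--supports stmt-CriticalPhenomena-4576`.

## Content

Finite weighted graph on `Fin n` (`μ = prodBernoulli w` on `BondConfig (Fin n)`, events
`{x ↔ y} = openConn x y`), two DISJOINT finite vertex sets `S, S'`, points `o, b`, and the
decreasing separation event `D' := {S ↮ S'} = {ω | ∀ s ∈ S, ∀ x ∈ S', s ↮ x}`.  Then

`μ(D') · μ(D' ∩ {S ↔ o} ∩ {S' ↔ b}) ≤ μ(D' ∩ {S ↔ o}) · μ(D' ∩ {S' ↔ b})`,

where `{S ↔ o} = ⋃_{s ∈ S} {s ↔ o}` ("`o ∈ C_S`") and `{S' ↔ b} = ⋃_{s ∈ S'} {s ↔ b}`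
("`b ∈ C_{S'}`", the ANY form).  This is van den Berg–Häggström–Kahn (2006) Thm. 1.4 for the
clusters `C_S, C_{S'}` of two disjoint vertex SETS given `{S ↮ S'}` — increasing `f(C_S)` and
increasing `g(C_{S'})` are negatively correlated given `D'` — with `f = 1{o ∈ C_S}`,
`g = 1{b ∈ C_{S'}}`.

Proof: exactly as the sibling `knThm2_bhkTwo` (file `…KnThm2GoodAux`, the "ALL" form
`g = 1{∀ s ∈ S', s ↔ b}`), with `G :=` the any-reach indicator for `S'` and `b`
(`knThm2_monotone_anyReach S' b`, `knThm2_anyReach_apply`), the general two-set BHK inequality being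
the second component of the landed `stub_bhkSets` (file `…BhkSets`), followed by the
`knThm2_setIntegral_indicator` bookkeeping `∫_D 1_E = μ(D ∩ E)`, `∫_D 1_E 1_{E'} = μ(D ∩ (E ∩ E'))`.
-/

namespace Summit.CriticalPhenomena.PercolationContinuityZ3.Theorems

open MeasureTheory Set Literature.Probability.LatticeModels Literature.Probability.Percolation

noncomputable section
open Classical

/-- **BHK 2006 Thm. 1.4 for the clusters of disjoint vertex sets `S, S'`, with `f = 1{S ↔ o}`,
`g = 1{S' ↔ b}` (both in the ANY form):** `μ(D') μ(D' ∩ {S ↔ o} ∩ {S' ↔ b}) ≤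
μ(D' ∩ {S ↔ o}) μ(D' ∩ {S' ↔ b})`, `D' = {S ↮ S'}`, `{S ↔ o} = ⋃_{s ∈ S} {s ↔ o}`,
`{S' ↔ b} = ⋃_{s ∈ S'} {s ↔ b}` (the cross atom with "`b` joins SOME vertex of `S'`"; fed by the
second half of the landed `stub_bhkSets`). [cite: VandenbergHaggstromKahn2005, Thm. 1.4 (p. 7)] -/
theorem stub_bhkTwoAny_c7 : ∀ (n : ℕ) (w : Sym2 (Fin n) → unitInterval) (S S' : Finset (Fin n)) (o b : Fin n),
    Disjoint S S' →
    (prodBernoulli w).real {ω : BondConfig (Fin n) | ∀ s ∈ S, ∀ x ∈ S', ¬ (openGraph ω).Reachable s x} *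
        (prodBernoulli w).real
          ({ω : BondConfig (Fin n) | ∀ s ∈ S, ∀ x ∈ S', ¬ (openGraph ω).Reachable s x} ∩
            ((⋃ s ∈ S, openConn s o) ∩ ⋃ s ∈ S', openConn s b)) ≤
      (prodBernoulli w).real
          ({ω : BondConfig (Fin n) | ∀ s ∈ S, ∀ x ∈ S', ¬ (openGraph ω).Reachable s x} ∩ ⋃ s ∈ S, openConn s o) *
        (prodBernoulli w).real
          ({ω : BondConfig (Fin n) | ∀ s ∈ S, ∀ x ∈ S', ¬ (openGraph ω).Reachable s x} ∩ ⋃ s ∈ S', openConn s b) := by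
  intro n w S S' o b hSS'
  have key := stub_bhkSets.2 n w S S'
    ({C : Set (Sym2 (Fin n)) | ∃ s ∈ S, (openGraph C).Reachable s o}.indicator 1)
    ({C : Set (Sym2 (Fin n)) | ∃ s ∈ S', (openGraph C).Reachable s b}.indicator 1)
    (knThm2_monotone_anyReach S o) (knThm2_monotone_anyReach S' b) hSS'
  simp only [knThm2_anyReach_apply] at key
  have h := knThm2_setIntegral_indicator w
    {ω : BondConfig (Fin n) | ∀ s ∈ S, ∀ x ∈ S', ¬ (openGraph ω).Reachable s x}
    (⋃ s ∈ S, openConn s o) (⋃ s ∈ S', openConn s b)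
  have h' := knThm2_setIntegral_indicator w
    {ω : BondConfig (Fin n) | ∀ s ∈ S, ∀ x ∈ S', ¬ (openGraph ω).Reachable s x}
    (⋃ s ∈ S', openConn s b) (⋃ s ∈ S', openConn s b)
  rw [h.1, h'.1, h.2] at key
  exact key

end

end Summit.CriticalPhenomena.PercolationContinuityZ3.Theorems
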